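import Mathlib
import Literature.NumberTheory.LFunctions.Zhang2022.Section17U011MeanValue
import Literature.NumberTheory.LFunctions.Zhang2022.TypedSection17Identities
import Literature.NumberTheory.LFunctions.Zhang2022.Section17Eq177HeadMoments
import Literature.NumberTheory.LFunctions.Zhang2022.ToolkitDivisorMajorants
import HarnessLib

/-!
# Zhang (2022) §17 (17.7), the `Ψ₁ → Ψ` extension on `𝔍(−1)`: the `ϱ*`-series inside `𝔨₃*(s,ψ)` —
# head/tail splitting, holomorphy, and the trivial bounds far to the left (tools)

Topic `Literature/NumberTheory/LFunctions/Zhang2022` (Landau–Siegel audit tree; verdict-neutral).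
Y. Zhang, *Discrete mean estimates and the Landau–Siegel zero*, arXiv:2211.02515v1 (2022)
[Zhang2022LandauSiegel] — **an unrefereed manuscript under adjudication; nothing here asserts or
denies its Theorems 1–2.** ZHANG-L discharge lane (helper under node `Typed.Section17.Eq17_7`, the
(17.7) input of leaf `Typed.Section17.Eq17_9RelE`); THEOREM-ONLY.

§17 p. 97 (tex L4785): "Moving the segment `𝔍(−α)` to `𝔍(−1)` and then extend the sum over `Ψ₁` to
the sum over `Ψ` we obtain (17.7)". As in the proofs of (7.3) (§7 pp. 34–35) and of §15 u009 (the
tree's `Typed.Section15A.U009.*`), the `Ψ₂ = Ψ ∖ Ψ₁` part is handled by splitting the Dirichlet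
series factor of the integrand. Here, for `Re s < 0` (§17.u016–u017, tree
`Typed.Section17.step17_u017_le_holds`),
`𝔨₃*(s,ψ) = (Σ_n ϱ*_≤(n)ψ̄(n)n^{−(1−s)})·B(s,ψ)G(s,ψ)N(s+β₂,ψ)N(s+β₃,ψ)`, `ϱ*_≤ = (ν·[≤D⁴]) ∗ κ̄₂`
(`|ϱ*_≤| ≤ τ₂ ∗ τ₂ = τ₄`), and the series is split in the reflected variable `w = 1 − s` at
`n ≤ X`: head (an entire finite sum) + tail (the `LSeries` of `n ↦ [X < n]ϱ*_≤(n)ψ̄(n)`, holomorphic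
on `Re w > 1`, of size `≤ S₄(X+1)^{3/2−Re w}` for `Re w ≥ 3/2`). This file provides, for a GENERIC
coefficient sequence `a` with `|a(n)| ≤ τ_k(n)`:
* `tsum_tauTwist_eq_head_add_LSeries`, `LSeriesSummable_tauTwist_tail`,
  `differentiableOn_LSeries_tauTwist_tail`, `differentiable_tauTwist_head`,
  `norm_LSeries_tauTwist_tail_le` (the §7/§15 tools, coefficient-generic);
and for the §17 objects:
* `kfrak3Star_eq_tsum_mul_BGNN` (`Re s < 0`; `|ϱ*_≤| ≤ τ₄` is `Eq177.norm_varrhoLe_le_tau` of the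
  tree's `Section17Eq177HeadMoments`),
  `kfrak3Star_mul_omega_sub_head_eq` (`𝔨₃*ω −` head part `=` tail·`BGNN`·`ω` on `Re s < 0`);
* `norm_bcoefChi_conv_nuOneStar_le` (`|((bχ)∗ν₁*)(n)| ≤ K_ιτ₆(n)`), `norm_BGNN_le_of_re_nonpos`
  (`|BGNN(s)| ≤ K_ι⌊P⌋⁷·⌊P⌋^{−σ}` for `σ ≤ 0`, via `BGNN_eq_sum_Icc`), `norm_tail_BGNN_le`
  (the pointwise bound on `Re s ≤ −1/2`: `≤ S₄K_ι⌊P⌋⁶(⌊P²⌋+1)²·b^{Re(1−s)}`, `b = ⌊P⌋/(⌊P²⌋+1)`),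
  `floorP_div_le_inv_bigT` (`b ≤ T⁻¹`).
The §17 twin of the tree's `Section15U009TailBounds` / `Section14Eq143TailBounds`.

## References

* Y. Zhang, arXiv:2211.02515v1 (2022), §17 (17.7) p. 97, tex L4780–L4809; §7 pp. 34–35, tex
  L1874–L1899; §15 p. 80, tex L4037. [cite: Zhang2022LandauSiegel, §17 (17.7) p. 97]
-/

noncomputable section

open Complex Real
open scoped ComplexConjugate LSeries.notation

namespace Literature.NumberTheory.LFunctions.Zhang2022.Eq177

open Skeleton Typed.Section17 MeanSquareMajorant

/-! ### Generic tools: a `ψ̄`-twisted Dirichlet series with a divisor-type majorant -/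

section Generic

variable {D : ℕ} (x : Chr D) {a : ℕ → ℂ} {k : ℕ} (ha : ∀ n, ‖a n‖ ≤ tau k n)

include ha in
/-- Termwise bound: `|a(m)ψ̄(m)m^{−w}| ≤ τ_k(m)m^{−Re w}`. [cite: Zhang2022LandauSiegel, §7 p. 34, tex L1877] -/
theorem norm_tauTwist_term_le (w : ℂ) (m : ℕ) :
    ‖a m * conj (x.ψ (m : ZMod x.p)) * (m : ℂ) ^ (-w)‖ ≤ tau k m * (m : ℝ) ^ (-w.re) := by
  rcases Nat.eq_zero_or_pos m with rfl | hm
  · have h0 : x.ψ ((0 : ℕ) : ZMod x.p) = 0 := by rw [Nat.cast_zero, MulChar.map_zero]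
    rw [h0, map_zero, mul_zero, zero_mul, norm_zero]
    exact mul_nonneg (tau_nonneg k 0) (Real.rpow_nonneg (Nat.cast_nonneg 0) _)
  · rw [norm_mul, norm_mul, Complex.norm_conj, Complex.norm_natCast_cpow_of_pos hm, Complex.neg_re]
    have h2 : ‖x.ψ (m : ZMod x.p)‖ ≤ 1 := DirichletCharacter.norm_le_one _ _
    calc ‖a m‖ * ‖x.ψ (m : ZMod x.p)‖ * (m : ℝ) ^ (-w.re) ≤ tau k m * 1 * (m : ℝ) ^ (-w.re) :=
          mul_le_mul_of_nonneg_right (mul_le_mul (ha m) h2 (norm_nonneg _) (tau_nonneg k m))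
            (Real.rpow_nonneg (Nat.cast_nonneg m) _)
      _ = tau k m * (m : ℝ) ^ (-w.re) := by ring

include ha in
/-- **Absolute convergence for `Re w > 1`** of `Σ_m a(m)ψ̄(m)m^{−w}`. [cite: Zhang2022LandauSiegel, §17 u016 p. 97] -/
theorem summable_tauTwist {w : ℂ} (hw : 1 < w.re) :
    Summable fun m : ℕ => a m * conj (x.ψ (m : ZMod x.p)) * (m : ℂ) ^ (-w) :=
  Summable.of_norm_bounded (summable_tau_mul_rpow_neg k hw) (norm_tauTwist_term_le x ha w)

omit ha in
/-- The `LSeries` terms of the tail sequence `m ↦ [X < m]a(m)ψ̄(m)` are the terms `m > X` of the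
series. [cite: Zhang2022LandauSiegel, §7 p. 34, tex L1877] -/
theorem term_tauTwist_tail_eq (X : ℕ) (w : ℂ) (m : ℕ) :
    LSeries.term (fun m : ℕ => if X < m then a m * conj (x.ψ (m : ZMod x.p)) else 0) w m =
      if X < m then a m * conj (x.ψ (m : ZMod x.p)) * (m : ℂ) ^ (-w) else 0 := by
  rcases Nat.eq_zero_or_pos m with rfl | hm
  · rw [LSeries.term_zero, if_neg (Nat.not_lt_zero X)]
  · rw [LSeries.term_of_ne_zero hm.ne']
    split_ifs
    · rw [Complex.cpow_neg, div_eq_mul_inv]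
    · rw [zero_div]

include ha in
/-- The tail sequence is `LSeries`-summable for `Re w > 1`. [cite: Zhang2022LandauSiegel, §7 p. 34, tex L1878] -/
theorem LSeriesSummable_tauTwist_tail (X : ℕ) {w : ℂ} (hw : 1 < w.re) :
    LSeriesSummable (fun m : ℕ => if X < m then a m * conj (x.ψ (m : ZMod x.p)) else 0) w := by
  unfold LSeriesSummable
  rw [show LSeries.term (fun m : ℕ => if X < m then a m * conj (x.ψ (m : ZMod x.p)) else 0) w =
      fun m => if X < m then a m * conj (x.ψ (m : ZMod x.p)) * (m : ℂ) ^ (-w) else 0 from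
    funext (term_tauTwist_tail_eq x X w)]
  refine Summable.of_norm_bounded (summable_tau_mul_rpow_neg k hw) fun m => ?_
  split_ifs
  · exact norm_tauTwist_term_le x ha w m
  · rw [norm_zero]
    exact le_trans (norm_nonneg _) (norm_tauTwist_term_le x ha w m)

include ha in
/-- **Splitting at `X`**: for `Re w > 1`,
`Σ_m a(m)ψ̄(m)m^{−w} = Σ_{1≤m≤X} a(m)ψ̄(m)m^{−w} + Σ_{m>X} a(m)ψ̄(m)m^{−w}`, the tail as an `LSeries`.
[cite: Zhang2022LandauSiegel, §7 p. 34, tex L1877; §17 (17.7) p. 97] -/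
theorem tsum_tauTwist_eq_head_add_LSeries (X : ℕ) {w : ℂ} (hw : 1 < w.re) :
    ∑' m : ℕ, a m * conj (x.ψ (m : ZMod x.p)) * (m : ℂ) ^ (-w) =
      ∑ m ∈ Finset.Icc 1 X, a m * conj (x.ψ (m : ZMod x.p)) * (m : ℂ) ^ (-w) +
        LSeries (fun m : ℕ => if X < m then a m * conj (x.ψ (m : ZMod x.p)) else 0) w := by
  set f : ℕ → ℂ := fun m => a m * conj (x.ψ (m : ZMod x.p)) * (m : ℂ) ^ (-w) with hf
  have hsum : Summable f := summable_tauTwist x ha hw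
  have hsplit : ∀ m, f m = (if m ≤ X then f m else 0) + (if X < m then f m else 0) := by
    intro m
    by_cases h : m ≤ X
    · rw [if_pos h, if_neg (not_lt.mpr h), add_zero]
    · rw [if_neg h, if_pos (not_le.mp h), zero_add]
  have h1 : Summable fun m => if m ≤ X then f m else 0 := by
    refine summable_of_ne_finset_zero (s := Finset.range (X + 1)) fun m hm => ?_
    rw [Finset.mem_range, not_lt] at hm
    exact if_neg (by omega)
  have h2 : Summable fun m => if X < m then f m else 0 := by
    have := LSeriesSummable_tauTwist_tail x ha X hw
    unfold LSeriesSummable at this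
    rwa [show LSeries.term (fun m : ℕ => if X < m then a m * conj (x.ψ (m : ZMod x.p)) else 0) w =
        fun m => if X < m then a m * conj (x.ψ (m : ZMod x.p)) * (m : ℂ) ^ (-w) else 0 from
      funext (term_tauTwist_tail_eq x X w)] at this
  have hf0 : f 0 = 0 := by
    rw [hf]; simp only [Nat.cast_zero, MulChar.map_zero, map_zero, mul_zero, zero_mul]
  rw [LSeries]
  simp_rw [term_tauTwist_tail_eq]
  calc ∑' m, f m = ∑' m, ((if m ≤ X then f m else 0) + (if X < m then f m else 0)) :=
        tsum_congr hsplit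
    _ = ∑' m, (if m ≤ X then f m else 0) + ∑' m, (if X < m then f m else 0) := h1.tsum_add h2
    _ = ∑ m ∈ Finset.Icc 1 X, f m + ∑' m, (if X < m then f m else 0) := by
        congr 1
        rw [tsum_eq_sum (s := Finset.range (X + 1)) fun m hm => by
          rw [Finset.mem_range, not_lt] at hm; exact if_neg (by omega)]
        rw [Finset.sum_congr rfl fun m hm => if_pos (by
          have := Finset.mem_range.mp hm; omega), Finset.range_eq_Ico]
        have e : Finset.Ico 0 (X + 1) = insert 0 (Finset.Icc 1 X) := by
          ext m; simp only [Finset.mem_Ico, Finset.mem_insert, Finset.mem_Icc]; omega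
        rw [e, Finset.sum_insert (by simp)]
        simp only [hf] at hf0 ⊢
        rw [hf0, zero_add]

include ha in
/-- **The tail `LSeries` is holomorphic on `Re w > 1`** (its abscissa of absolute convergence is
`≤ 1`). [cite: Zhang2022LandauSiegel, §7 p. 35, tex L1890] -/
theorem differentiableOn_LSeries_tauTwist_tail (X : ℕ) :
    DifferentiableOn ℂ
      (LSeries fun m : ℕ => if X < m then a m * conj (x.ψ (m : ZMod x.p)) else 0)
      {w : ℂ | 1 < w.re} := by
  have habs : LSeries.abscissaOfAbsConv
      (fun m : ℕ => if X < m then a m * conj (x.ψ (m : ZMod x.p)) else 0) ≤ (1 : ℝ) :=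
    LSeries.abscissaOfAbsConv_le_of_forall_lt_LSeriesSummable fun y hy =>
      LSeriesSummable_tauTwist_tail x ha X (by simpa using hy)
  refine (LSeries_differentiableOn _).mono fun w hw => ?_
  exact lt_of_le_of_lt habs (by exact_mod_cast hw)

omit ha in
/-- The head `Σ_{1≤m≤X} a(m)ψ̄(m)m^{−w}` is entire. [cite: Zhang2022LandauSiegel, §7 p. 34, tex L1877] -/
theorem differentiable_tauTwist_head (X : ℕ) :
    Differentiable ℂ fun w : ℂ =>
      ∑ m ∈ Finset.Icc 1 X, a m * conj (x.ψ (m : ZMod x.p)) * (m : ℂ) ^ (-w) := by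
  refine Differentiable.fun_sum fun m hm => ?_
  have hm1 : (m : ℂ) ≠ 0 := Nat.cast_ne_zero.mpr (by have := (Finset.mem_Icc.mp hm).1; omega)
  exact (differentiable_const _).mul (differentiable_id.neg.const_cpow (Or.inl hm1))

include ha in
/-- **Rankin-type bound for the tail on `Re w ≥ 3/2`**: `|Σ_{m>X} a(m)ψ̄(m)m^{−w}| ≤ S_k·(X+1)^{3/2−Re w}`,
`S_k = Σ_m τ_k(m)m^{−3/2}` (termwise `m^{−Re w} ≤ (X+1)^{3/2−Re w}m^{−3/2}` for `m > X`).
[cite: Zhang2022LandauSiegel, §7 p. 34, tex L1878; §17 (17.7) p. 97] -/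
theorem norm_LSeries_tauTwist_tail_le (X : ℕ) {w : ℂ} (hw : 3 / 2 ≤ w.re) :
    ‖LSeries (fun m : ℕ => if X < m then a m * conj (x.ψ (m : ZMod x.p)) else 0) w‖ ≤
      (∑' m : ℕ, tau k m * (m : ℝ) ^ (-(3 / 2 : ℝ))) * ((X : ℝ) + 1) ^ (3 / 2 - w.re) := by
  have hsum := summable_tau_mul_rpow_neg k (σ := 3 / 2) (by norm_num)
  set S : ℝ := ∑' m : ℕ, tau k m * (m : ℝ) ^ (-(3 / 2 : ℝ)) with hSdef
  set σ := w.re with hσ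
  set Y : ℝ := (X : ℝ) + 1 with hY
  have hY0 : 0 < Y := by positivity
  set g : ℕ → ℝ := fun m => Y ^ (3 / 2 - σ) * (tau k m * (m : ℝ) ^ (-(3 / 2 : ℝ))) with hg
  have hg_summ : Summable g := hsum.mul_left _
  have hK0 : 0 ≤ Y ^ (3 / 2 - σ) := Real.rpow_nonneg hY0.le _
  have hg0 : ∀ m, 0 ≤ g m := fun m => mul_nonneg hK0
    (mul_nonneg (tau_nonneg k m) (Real.rpow_nonneg (Nat.cast_nonneg m) _))
  have hf : ∀ m : ℕ,
      ‖(if X < m then a m * conj (x.ψ (m : ZMod x.p)) * (m : ℂ) ^ (-w) else 0)‖ ≤ g m := by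
    intro m
    split_ifs with hm
    · have hm0 : 0 < m := by omega
      have hmY : Y ≤ m := by rw [hY]; exact_mod_cast hm
      have hm0' : (0 : ℝ) < m := by exact_mod_cast hm0
      refine (norm_tauTwist_term_le x ha w m).trans ?_
      rw [hg, ← hσ]
      have h2 : (m : ℝ) ^ (-σ) ≤ Y ^ (3 / 2 - σ) * (m : ℝ) ^ (-(3 / 2 : ℝ)) := by
        rw [show -σ = -(σ - 3 / 2) + -(3 / 2 : ℝ) by ring, Real.rpow_add hm0',
          show (3 / 2 : ℝ) - σ = -(σ - 3 / 2) by ring]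
        exact mul_le_mul_of_nonneg_right
          (Real.rpow_le_rpow_of_nonpos hY0 hmY (by linarith)) (Real.rpow_nonneg hm0'.le _)
      calc tau k m * (m : ℝ) ^ (-σ)
          ≤ tau k m * (Y ^ (3 / 2 - σ) * (m : ℝ) ^ (-(3 / 2 : ℝ))) :=
            mul_le_mul_of_nonneg_left h2 (tau_nonneg k m)
        _ = Y ^ (3 / 2 - σ) * (tau k m * (m : ℝ) ^ (-(3 / 2 : ℝ))) := by ring
    · rw [norm_zero]; exact hg0 m
  have hsumm : Summable fun m : ℕ =>
      ‖(if X < m then a m * conj (x.ψ (m : ZMod x.p)) * (m : ℂ) ^ (-w) else 0)‖ :=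
    Summable.of_nonneg_of_le (fun _ => norm_nonneg _) hf hg_summ
  rw [LSeries]
  simp_rw [term_tauTwist_tail_eq]
  calc ‖∑' m : ℕ, (if X < m then a m * conj (x.ψ (m : ZMod x.p)) * (m : ℂ) ^ (-w) else 0)‖
      ≤ ∑' m : ℕ, ‖(if X < m then a m * conj (x.ψ (m : ZMod x.p)) * (m : ℂ) ^ (-w) else 0)‖ :=
        norm_tsum_le_tsum_norm hsumm
    _ ≤ ∑' m : ℕ, g m := Summable.tsum_le_tsum hf hsumm hg_summ
    _ = Y ^ (3 / 2 - σ) * S := by rw [hSdef, ← tsum_mul_left]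
    _ = S * Y ^ (3 / 2 - σ) := by ring

end Generic

/-! ### The coefficient `ϱ*_≤ = (ν·[≤D⁴]) ∗ κ̄₂` of §17.u017 -/

section Varrho

variable (c' : ℝ) {D : ℕ} (χ : DirichletCharacter ℂ D)

/-- **`𝔨₃*(s,ψ) = (Σ_n ϱ*_≤(n)ψ̄(n)n^{−(1−s)})·B(s,ψ)G(s,ψ)N(s+β₂,ψ)N(s+β₃,ψ)` for `Re s < 0`**
(§17.u016–u017 in the `l ≤ D⁴` reading, the tree's `step17_u017_le_holds`).
[cite: Zhang2022LandauSiegel, §17 u012, u017 p. 97] -/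
theorem kfrak3Star_eq_tsum_mul_BGNN (x : Chr D) {s : ℂ} (hs : s.re < 0) :
    kfrak3Star c' χ x s =
      (∑' n : ℕ, (trunc (D ^ 4) (nu χ) ⍟ kappa2bar c' D) n * conj (x.ψ (n : ZMod x.p)) *
          (n : ℂ) ^ (-(1 - s))) *
        (Bpoly χ x s * Gpoly χ x s * Nchar D (psiFn x) (s + beta2 c' D) *
          Nchar D (psiFn x) (s + beta3 c' D)) := by
  rw [kfrak3Star, ← step17_u017_le_holds c' χ x s hs]
  ring

/-- **On `Re s < 0`, `𝔨₃*(s,ψ)ω(s)` minus its head part is the tail part**: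
`𝔨₃*ω − (Σ_{1≤n≤X} ϱ*_≤ψ̄(n)n^{−(1−s)})·BGNN·ω = (Σ_{n>X} ϱ*_≤ψ̄(n)n^{−(1−s)})·BGNN·ω`, the tail as the
`LSeries` of `n ↦ [X < n]ϱ*_≤(n)ψ̄(n)` at `1 − s`. [cite: Zhang2022LandauSiegel, §17 (17.7) p. 97; §7 p. 34] -/
theorem kfrak3Star_mul_omega_sub_head_eq (x : Chr D) (X : ℕ) {s : ℂ} (hs : s.re < 0) :
    kfrak3Star c' χ x s * omegaW D s -
        (∑ n ∈ Finset.Icc 1 X, (trunc (D ^ 4) (nu χ) ⍟ kappa2bar c' D) n *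
            conj (x.ψ (n : ZMod x.p)) * (n : ℂ) ^ (-(1 - s))) *
          (Bpoly χ x s * Gpoly χ x s * Nchar D (psiFn x) (s + beta2 c' D) *
            Nchar D (psiFn x) (s + beta3 c' D)) * omegaW D s =
      LSeries (fun n : ℕ => if X < n then (trunc (D ^ 4) (nu χ) ⍟ kappa2bar c' D) n *
          conj (x.ψ (n : ZMod x.p)) else 0) (1 - s) *
        (Bpoly χ x s * Gpoly χ x s * Nchar D (psiFn x) (s + beta2 c' D) *
          Nchar D (psiFn x) (s + beta3 c' D)) * omegaW D s := by
  have hw : 1 < (1 - s).re := by simp only [sub_re, one_re]; linarith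
  rw [kfrak3Star_eq_tsum_mul_BGNN c' χ x hs,
    tsum_tauTwist_eq_head_add_LSeries x (norm_varrhoLe_le_tau c' χ) X hw]
  ring

end Varrho

/-! ### The polynomial `BGNN` far to the left -/

section BGNN

variable (c' : ℝ) {D : ℕ} [NeZero D] (χ : DirichletCharacter ℂ D)

omit [NeZero D] in
/-- **`|((bχ) ∗ ν₁*)(n)| ≤ K_ι·τ₆(n)`**, `K_ι = (1+|ι₂|)(|ι₃|+|ι₄|)` (`bχ ≪ K_ιτ₂` (15.2); `ν₁* =
υ·[≤D⁴] ∗ nN β₂ ∗ nN β₃ ≪ τ₂ ∗ τ₁ ∗ τ₁ = τ₄`; for `log D ≥ 2`, `𝓛 > 0`).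
[cite: Zhang2022LandauSiegel, §15 (15.2) p. 79; §17 u014–u015 p. 97] -/
theorem norm_bcoefChi_conv_nuOneStar_le (hD : 2 ≤ Real.log D) (hℓ : 0 < ell D) (n : ℕ) :
    ‖((fun n => bcoef D n * χ (n : ZMod D)) ⍟ nuOneStar c' χ) n‖ ≤
      (1 + ‖iota2‖) * (‖iota3‖ + ‖iota4‖) * tau 6 n := by
  have hconv : ∀ (u v : ℕ → ℂ) (m : ℕ), (u ⍟ v) m = seqConv u v m := fun u v m => by
    rw [LSeries.convolution_def]; rfl
  have hβ2 : (beta2 c' D).re = 0 := by simp [beta2]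
  have hβ3 : (beta3 c' D).re = 0 := by simp [beta3]
  -- `ν₁* ≪ τ₄`
  have h3 : ∀ m, m ≠ 0 → ‖(trunc (D ^ 4) (ups χ) ⍟ nN D (beta2 c' D)) m‖ ≤ 1 * 1 * tau (2 + 1) m := by
    intro m _
    rw [hconv]
    exact norm_seqConv_le_tau zero_le_one (fun m _ => by rw [one_mul]; exact norm_trunc_ups_le χ m)
      (fun m hm => by rw [tau_one_apply hm, mul_one]; exact Phi3Eval.norm_nN_le_one hℓ hβ2 m) m
  have h4 : ∀ m, m ≠ 0 → ‖nuOneStar c' χ m‖ ≤ 1 * 1 * 1 * tau (2 + 1 + 1) m := by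
    intro m _
    rw [nuOneStar, hconv]
    exact norm_seqConv_le_tau (by norm_num) h3
      (fun m hm => by rw [tau_one_apply hm, mul_one]; exact Phi3Eval.norm_nN_le_one hℓ hβ3 m) m
  have h := norm_seqConv_le_tau (by positivity) (fun m _ => norm_bcoef_mul_chi_le χ hD m) h4 n
  rw [hconv]
  refine h.trans (le_of_eq ?_)
  norm_num

omit [NeZero D] χ in
/-- `τ_{j+1}(n) ≤ n^j` for `n ≥ 1` (crude: `#{d ∣ n} ≤ n`). [folklore] -/
private theorem tau_succ_le_pow (j : ℕ) : ∀ {n : ℕ}, n ≠ 0 → tau (j + 1) n ≤ (n : ℝ) ^ j := by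
  induction j with
  | zero => intro n hn; rw [tau_one_apply hn, pow_zero]
  | succ j ih =>
    intro n hn
    rw [tau_succ_apply]
    calc ∑ d ∈ n.divisors, tau (j + 1) d ≤ ∑ d ∈ n.divisors, (n : ℝ) ^ j := by
          refine Finset.sum_le_sum fun d hd => ?_
          have hd0 : d ≠ 0 := (Nat.pos_of_mem_divisors hd).ne'
          have hdn : (d : ℝ) ≤ n := by exact_mod_cast Nat.divisor_le hd
          exact (ih hd0).trans (pow_le_pow_left₀ (Nat.cast_nonneg d) hdn j)
      _ = (n.divisors.card : ℝ) * (n : ℝ) ^ j := by rw [Finset.sum_const, nsmul_eq_mul]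
      _ ≤ (n : ℝ) * (n : ℝ) ^ j := by
          gcongr; exact_mod_cast Nat.card_divisors_le_self n
      _ = (n : ℝ) ^ (j + 1) := by ring

/-- **`|B(s,ψ)G(s,ψ)N(s+β₂,ψ)N(s+β₃,ψ)| ≤ K_ι⌊P⌋⁷·⌊P⌋^{−σ}` for `σ = Re s ≤ 0`** (`D ≥ 3`, `𝓛 ≥ 4`):
`BGNN = Σ_{n≤⌊P⌋} ((bχ)∗ν₁*)(n)ψ(n)n^{−s}` (`BGNN_eq_sum_Icc`), each term
`≤ K_ιτ₆(n)n^{−σ} ≤ K_ι⌊P⌋⁵·⌊P⌋^{−σ}`. [cite: Zhang2022LandauSiegel, §17 u015 p. 97; §7 p. 34, tex L1878] -/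
theorem norm_BGNN_le_of_re_nonpos (hD : 3 ≤ D) (hℓ : 4 ≤ ell D) (x : Chr D) {s : ℂ} (hs : s.re ≤ 0) :
    ‖Bpoly χ x s * Gpoly χ x s * Nchar D (psiFn x) (s + beta2 c' D) *
        Nchar D (psiFn x) (s + beta3 c' D)‖ ≤
      (1 + ‖iota2‖) * (‖iota3‖ + ‖iota4‖) * (⌊bigP D⌋₊ : ℝ) ^ 7 * (⌊bigP D⌋₊ : ℝ) ^ (-s.re) := by
  set N : ℕ := ⌊bigP D⌋₊ with hN
  set K : ℝ := (1 + ‖iota2‖) * (‖iota3‖ + ‖iota4‖) with hK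
  have hK0 : 0 ≤ K := by positivity
  have hℓ0 : 0 < ell D := by linarith
  have hlog : 2 ≤ Real.log D := by rw [← ell]; linarith
  have hNσ : 0 ≤ (N : ℝ) ^ (-s.re) := Real.rpow_nonneg (Nat.cast_nonneg N) _
  rw [BGNN_eq_sum_Icc c' χ hD hℓ x s]
  have hterm : ∀ n ∈ Finset.Icc 1 N,
      ‖((fun n => bcoef D n * χ (n : ZMod D)) ⍟ nuOneStar c' χ) n * x.ψ (n : ZMod x.p) *
          (n : ℂ) ^ (-s)‖ ≤ K * (N : ℝ) ^ 5 * (N : ℝ) ^ (-s.re) := by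
    intro n hn
    have hn1 : 1 ≤ n := (Finset.mem_Icc.mp hn).1
    have hnN : n ≤ N := (Finset.mem_Icc.mp hn).2
    have hn0 : n ≠ 0 := by omega
    rw [norm_mul, norm_mul, Complex.norm_natCast_cpow_of_pos (by omega), Complex.neg_re]
    have h1 := norm_bcoefChi_conv_nuOneStar_le c' χ hlog hℓ0 n
    have h2 : ‖x.ψ (n : ZMod x.p)‖ ≤ 1 := DirichletCharacter.norm_le_one _ _
    have h3 : (n : ℝ) ^ (-s.re) ≤ (N : ℝ) ^ (-s.re) :=
      Real.rpow_le_rpow (Nat.cast_nonneg n) (by exact_mod_cast hnN) (by linarith)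
    have h4 : tau 6 n ≤ (N : ℝ) ^ 5 :=
      (tau_succ_le_pow 5 hn0).trans (pow_le_pow_left₀ (Nat.cast_nonneg _) (Nat.cast_le.mpr hnN) 5)
    have hKt : 0 ≤ K * tau 6 n := mul_nonneg hK0 (tau_nonneg 6 n)
    calc ‖((fun n => bcoef D n * χ (n : ZMod D)) ⍟ nuOneStar c' χ) n‖ * ‖x.ψ (n : ZMod x.p)‖ *
          (n : ℝ) ^ (-s.re) ≤ (K * tau 6 n) * 1 * (N : ℝ) ^ (-s.re) :=
          mul_le_mul (mul_le_mul h1 h2 (norm_nonneg _) hKt) h3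
            (Real.rpow_nonneg (Nat.cast_nonneg n) _) (by rw [mul_one]; exact hKt)
      _ ≤ K * (N : ℝ) ^ 5 * 1 * (N : ℝ) ^ (-s.re) :=
          mul_le_mul_of_nonneg_right (mul_le_mul_of_nonneg_right
            (mul_le_mul_of_nonneg_left h4 hK0) zero_le_one) hNσ
      _ = K * (N : ℝ) ^ 5 * (N : ℝ) ^ (-s.re) := by ring
  calc ‖∑ n ∈ Finset.Icc 1 N, ((fun n => bcoef D n * χ (n : ZMod D)) ⍟ nuOneStar c' χ) n *
          x.ψ (n : ZMod x.p) * (n : ℂ) ^ (-s)‖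
      ≤ ∑ n ∈ Finset.Icc 1 N, ‖((fun n => bcoef D n * χ (n : ZMod D)) ⍟ nuOneStar c' χ) n *
          x.ψ (n : ZMod x.p) * (n : ℂ) ^ (-s)‖ := norm_sum_le _ _
    _ ≤ ∑ n ∈ Finset.Icc 1 N, K * (N : ℝ) ^ 5 * (N : ℝ) ^ (-s.re) := Finset.sum_le_sum hterm
    _ = (N : ℝ) * (K * (N : ℝ) ^ 5 * (N : ℝ) ^ (-s.re)) := by
        rw [Finset.sum_const, Nat.card_Icc, nsmul_eq_mul]; simp
    _ ≤ (N : ℝ) ^ 2 * (K * (N : ℝ) ^ 5 * (N : ℝ) ^ (-s.re)) := by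
        refine mul_le_mul_of_nonneg_right ?_ (by positivity)
        rcases Nat.eq_zero_or_pos N with h0 | hpos
        · simp [h0]
        · have h1 : (1 : ℝ) ≤ N := by exact_mod_cast hpos
          nlinarith
    _ = K * (N : ℝ) ^ 7 * (N : ℝ) ^ (-s.re) := by ring

/-! ### Real bookkeeping and the pointwise bound on `Re s ≤ −1/2` -/

omit [NeZero D] χ in
/-- `Y^{3/2−u}·N^{u−1} ≤ Y²N⁻¹·(N/Y)^u` for `N > 0`, `Y ≥ 1`, `u ≥ 3/2`. [folklore] -/
private theorem rpow_bookkeeping' {Y Nr : ℝ} (hY : 1 ≤ Y) (hN : 0 < Nr) (u : ℝ) :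
    Y ^ (3 / 2 - u) * Nr ^ (u - 1) ≤ Y ^ 2 * Nr⁻¹ * (Nr / Y) ^ u := by
  have hY0 : 0 < Y := by linarith
  have h1 : Y ^ (3 / 2 - u) ≤ Y ^ (2 - u) := Real.rpow_le_rpow_of_exponent_le hY (by linarith)
  have hB : 0 < Y ^ u := Real.rpow_pos_of_pos hY0 u
  have e2 : Y ^ (2 - u) = Y ^ 2 / Y ^ u := by rw [Real.rpow_sub hY0, Real.rpow_two]
  have e3 : Nr ^ (u - 1) = Nr ^ u / Nr := Real.rpow_sub_one hN.ne' u
  have e4 : (Nr / Y) ^ u = Nr ^ u / Y ^ u := Real.div_rpow hN.le hY0.le u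
  have h0' : 0 ≤ Nr ^ (u - 1) := Real.rpow_nonneg hN.le _
  calc Y ^ (3 / 2 - u) * Nr ^ (u - 1) ≤ Y ^ (2 - u) * Nr ^ (u - 1) :=
        mul_le_mul_of_nonneg_right h1 h0'
    _ = Y ^ 2 * Nr⁻¹ * (Nr / Y) ^ u := by
        rw [e2, e3, e4]
        field_simp

/-- **The pointwise bound on `Re s ≤ −1/2`** (the §17 mirror of "tail `≪ P^{2(1−σ)}`, polynomial
`≪ (length)^σ`" of §7 p. 34): with `u = Re(1−s) ≥ 3/2`, `X = ⌊P²⌋`, `N = ⌊P⌋`,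
`|Σ_{n>X} ϱ*_≤ψ̄(n)n^{−(1−s)}|·|BGNN(s)| ≤ S₄K_ι N⁶(X+1)²·b^{u}`, `b = N/(X+1)`, `S₄ = Σ τ₄(m)m^{−3/2}`
(`D ≥ 3`, `𝓛 ≥ 4`). [cite: Zhang2022LandauSiegel, §7 p. 34, tex L1878–L1882; §17 (17.7) p. 97] -/
theorem norm_tail_BGNN_le (hD : 3 ≤ D) (hℓ : 4 ≤ ell D) (x : Chr D) {s : ℂ} (hs : s.re ≤ -1 / 2) :
    ‖LSeries (fun n : ℕ => if ⌊bigP D ^ 2⌋₊ < n then (trunc (D ^ 4) (nu χ) ⍟ kappa2bar c' D) n *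
          conj (x.ψ (n : ZMod x.p)) else 0) (1 - s) *
        (Bpoly χ x s * Gpoly χ x s * Nchar D (psiFn x) (s + beta2 c' D) *
          Nchar D (psiFn x) (s + beta3 c' D))‖ ≤
      (∑' m : ℕ, tau 4 m * (m : ℝ) ^ (-(3 / 2 : ℝ))) * ((1 + ‖iota2‖) * (‖iota3‖ + ‖iota4‖)) *
        (⌊bigP D⌋₊ : ℝ) ^ 6 * ((⌊bigP D ^ 2⌋₊ : ℝ) + 1) ^ 2 *
        ((⌊bigP D⌋₊ : ℝ) / ((⌊bigP D ^ 2⌋₊ : ℝ) + 1)) ^ (1 - s).re := by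
  set S : ℝ := ∑' m : ℕ, tau 4 m * (m : ℝ) ^ (-(3 / 2 : ℝ)) with hS
  set K : ℝ := (1 + ‖iota2‖) * (‖iota3‖ + ‖iota4‖) with hK
  set Nr : ℝ := (⌊bigP D⌋₊ : ℝ) with hNr
  set Y : ℝ := (⌊bigP D ^ 2⌋₊ : ℝ) + 1 with hY
  set u : ℝ := (1 - s).re with hu
  have hS0 : 0 ≤ S := tsum_nonneg fun m => mul_nonneg (tau_nonneg 4 m)
    (Real.rpow_nonneg (Nat.cast_nonneg m) _)
  have hK0 : 0 ≤ K := by positivity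
  have hu32 : 3 / 2 ≤ u := by rw [hu]; simp only [sub_re, one_re]; linarith
  have hure : -s.re = u - 1 := by rw [hu]; simp only [sub_re, one_re]; ring
  have hY1 : 1 ≤ Y := by rw [hY]; linarith [(Nat.cast_nonneg ⌊bigP D ^ 2⌋₊ : (0 : ℝ) ≤ _)]
  have hℓ1 : 1 ≤ ell D := by linarith
  have hNr0 : 0 < Nr := by
    rw [hNr]
    have : 0 < ⌊bigP D⌋₊ := by
      have := (sizes_two_le hD hℓ1).1; omega
    exact_mod_cast this
  have hL := norm_LSeries_tauTwist_tail_le x (norm_varrhoLe_le_tau c' χ) ⌊bigP D ^ 2⌋₊ (w := 1 - s) hu32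
  have hB := norm_BGNN_le_of_re_nonpos c' χ hD hℓ x (s := s) (by linarith)
  rw [hure] at hB
  have hbk := rpow_bookkeeping' hY1 hNr0 u
  have hL0 : 0 ≤ S * Y ^ (3 / 2 - u) := mul_nonneg hS0 (Real.rpow_nonneg (by linarith) _)
  rw [norm_mul]
  calc ‖LSeries (fun n : ℕ => if ⌊bigP D ^ 2⌋₊ < n then (trunc (D ^ 4) (nu χ) ⍟ kappa2bar c' D) n *
          conj (x.ψ (n : ZMod x.p)) else 0) (1 - s)‖ *
        ‖Bpoly χ x s * Gpoly χ x s * Nchar D (psiFn x) (s + beta2 c' D) *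
          Nchar D (psiFn x) (s + beta3 c' D)‖
      ≤ (S * Y ^ (3 / 2 - u)) * (K * Nr ^ 7 * Nr ^ (u - 1)) :=
        mul_le_mul hL hB (norm_nonneg _) hL0
    _ = S * K * Nr ^ 7 * (Y ^ (3 / 2 - u) * Nr ^ (u - 1)) := by ring
    _ ≤ S * K * Nr ^ 7 * (Y ^ 2 * Nr⁻¹ * (Nr / Y) ^ u) :=
        mul_le_mul_of_nonneg_left hbk (by positivity)
    _ = S * K * Nr ^ 6 * Y ^ 2 * (Nr / Y) ^ u := by
        have hNr' : Nr ≠ 0 := hNr0.ne'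
        field_simp

omit [NeZero D] χ in
/-- **`b = ⌊P⌋/(⌊P²⌋+1) ≤ T⁻¹`** (`⌊P⌋ ≤ P`, `⌊P²⌋ + 1 ≥ P²`, `T ≤ P`): the base of the `(1−σ)`-power in
`norm_tail_BGNN_le`. [cite: Zhang2022LandauSiegel, §7 p. 34–35, tex L1878–L1890] -/
theorem floorP_div_le_inv_bigT (hℓ : 1 ≤ ell D) :
    (⌊bigP D⌋₊ : ℝ) / ((⌊bigP D ^ 2⌋₊ : ℝ) + 1) ≤ (bigT D)⁻¹ := by
  have hP0 : 0 < bigP D := Real.exp_pos _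
  have hT0 : 0 < bigT D := Real.exp_pos _
  have hYP : bigP D ^ 2 ≤ (⌊bigP D ^ 2⌋₊ : ℝ) + 1 := (Nat.lt_floor_add_one _).le
  have hN : (⌊bigP D⌋₊ : ℝ) ≤ bigP D := Nat.floor_le hP0.le
  have hTP : bigT D ≤ bigP D := by
    rw [bigT, bigP]
    apply Real.exp_le_exp.mpr
    calc ell D ^ (1.1 : ℝ) ≤ ell D ^ ((9 : ℕ) : ℝ) := Real.rpow_le_rpow_of_exponent_le hℓ (by norm_num)
      _ = ell D ^ 9 := Real.rpow_natCast _ _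
  calc (⌊bigP D⌋₊ : ℝ) / ((⌊bigP D ^ 2⌋₊ : ℝ) + 1) ≤ bigP D / bigP D ^ 2 :=
        div_le_div₀ hP0.le hN (by positivity) hYP
    _ = (bigP D)⁻¹ := by field_simp
    _ ≤ (bigT D)⁻¹ := by rw [inv_le_inv₀ hP0 hT0]; exact hTP

end BGNN

end Literature.NumberTheory.LFunctions.Zhang2022.Eq177
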